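/-
Copyright (c) 2026 the pub-hodgecm-mathlib formalisation cell (harness21).  Prover seat hodgecm-mathlib-K2Liu-p03 (g6): Track B «K2-LIT»,
#184♮ = hLiu418 = stmt-HodgeConjecture-24832, road `K2_Liu`, Road I organ (A-int)-fin, A7-reg = the Gindikin–Karpelevich COCYCLE road
(RULINGS M-156m ∕ M-156m′: B1 → B2 → B3 to this hand), file B1a-2 (heads `K2/K2Liu-p03/g6/HEADS-B1-BorelFrame.K2Liu-p03-g6.md` 5178151889657773).
-/
import Summits.HodgeConjecture.HodgeConjecture.Theorems.K2LiuDoubledUTwoTwoBorelFrame   -- B1a-1: `antidiagFour`, `unitaryOfMatrix'`, root letters, torus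
import HarnessLib

/-!
# Crux `HLiu418`, road `K2_Liu`, organ (A-int)-fin, A7-reg file B1a-2: THE WEYL LETTERS OF `U(J₄)`, THE SIEGEL DATA AND THE COCYCLE WORD
# `w_Δ · n(x,z,y) = (w₂ u₂(y)) · (w₁ u₁(z)) · (w₂ u₂(x))` (pure algebra over a commutative ring with involution)

Cell `hodgecm-mathlib`, crux item hLiu418 = `stmt-HodgeConjecture-24832`; squad K2 ∕ K2Liu; prover K2Liu-p03 (g6).  DEFINITIONS WITH BODIES + their
algebra (review lane `--kind definition`, `--supports stmt-HodgeConjecture-24832 --as helper`); no `instance`, no notation, no named-fact hypothesis, no `sorry`.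
Setting and letters of B1a-1 ★ `K2LiuDoubledUTwoTwoBorelFrame` (`R`, `σ`, `J₄`, `G = unitaryGroupOfForm σ J₄`, `uLongOne`, `uLongTwo`, `uPlus`, `uMinus`, `torusElt`).
* §4 THE WEYL LETTERS `weylOne = perm (0 1)(2 3)` (`s_{α₁}`), `weylTwo = perm (1 2)` (`s_{α₂}`) — permutation matrices IN `G`, squares `1`, no signs — and the
  conjugation table `w₂ u_{e₁−e₂}(z) = u_{e₁+e₂}(z) w₂`, `w₁ u_{2e₂}(x) = u_{2e₁}(x) w₁`, `w₂ u_{2e₁}(y) = u_{2e₁}(y) w₂`, `w₁ t(a,b) = t(b,a) w₁`, `w₂ t(a,b) = t(a, σ(b)⁻¹) w₂`.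
* §5 THE SIEGEL DATA OF `U(J₄)`: `weylSiegel := weylTwo * weylOne * weylTwo` (= perm `(0 2)(1 3)`, swapping the diagonal `2 × 2` blocks; `J₄ = w_Δ w₁`), the Siegel
  unipotent `nSiegel x z y := uLongTwo x * uPlus z * uLongOne y = [[1, X], [0, 1]]`, `X = (z y; x −σz)` (additive, injective, and EVERY block-unitriangular element
  of `G` is of this form: `exists_eq_nSiegel`), and ★★ THE COCYCLE WORD **`weylSiegel * nSiegel x z y = (weylTwo * uLongTwo y) * (weylOne * uMinus z) * (weylTwo * uLongTwo x)`**
  — the reduced word `w_Δ = s₂ s₁ s₂` read on the unipotent radical: the Siegel intertwining integral `∫_{N_Δ} f(w_Δ n h) dn` becomes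
  `∫_y ∫_z ∫_x f((w₂u₂(y))(w₁u₁(z))(w₂u₂(x)) h) = A₂(A₁(A₂ f))(h)` with the RANK-ONE operators `A_i f (g) := ∫ f(w_i u_{α_i}(t) g) dt` over the SIMPLE root groups
  (`t₀ = 1`, no sign; file B4 `K2LiuSiegelIntertwiningCocycle`, K2Liu-p09).
HONEST LABEL.  Carriers only, count-neutral: `HC_CM` is proved only modulo the 7 printed citations (2 remaining named inputs: hLiu418 = `stmt-HodgeConjecture-24832`,
h413 = `stmt-HodgeConjecture-24833`) until rung 0 closes.

## References
* [Casselman1980] W. Casselman, Compositio Math. 40 (1980): §3 (rank-one operators, the cocycle `T_{w₁w₂} = T_{w₁}T_{w₂}`, `c_α`).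
* [HarrisKudlaSweet1996] M. Harris, S. Kudla, W. J. Sweet, J. AMS 9 (1996): §1 (1.11)–(1.12), §6 (6.14)–(6.16).
* [Mok2014] C. P. Mok, Mem. AMS 235 (2015): §1 Notation p. 5.
-/

set_option autoImplicit false
set_option linter.dupNamespace false -- the mandated namespace repeats `HodgeConjecture.HodgeConjecture`

noncomputable section

open Matrix
open Literature.NumberTheory.Automorphic
open Summit.HodgeConjecture.HodgeConjecture.Cruxes.HLiu418.K2LiuDoubledUTwoTwoBorelFrame

namespace Summit.HodgeConjecture.HodgeConjecture.Cruxes.HLiu418.K2LiuDoubledUTwoTwoWeylCocycle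

variable (R : Type*) [CommRing R] (σ : R →+* R)

/-! ## §4 The Weyl letters `w₁ = perm (0 1)(2 3)` (`s_{α₁}`), `w₂ = perm (1 2)` (`s_{α₂}`) -/

/-- matrix of `w₁`: the permutation `(0 1)(2 3)` (reflection in the short simple root `α₁ = e₁ − e₂`). [cite: Casselman1980, §3] -/
def weylOneM : Matrix (Fin 4) (Fin 4) R := !![0, 1, 0, 0; 1, 0, 0, 0; 0, 0, 0, 1; 0, 0, 1, 0]

/-- matrix of `w₂`: the permutation `(1 2)` (reflection in the long simple root `α₂ = 2e₂`). [cite: Casselman1980, §3] -/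
def weylTwoM : Matrix (Fin 4) (Fin 4) R := !![1, 0, 0, 0; 0, 0, 1, 0; 0, 1, 0, 0; 0, 0, 0, 1]

variable {R} in
/-- `w₁` preserves `J₄` (no sign needed in `U(J₄)`). [cite: Casselman1980, §3] -/
theorem weylOneM_unitary : ((weylOneM R).map σ)ᵀ * antidiagFour R * weylOneM R = antidiagFour R := by
  ext i j
  fin_cases i <;> fin_cases j <;> simp [weylOneM, antidiagFour, Matrix.mul_apply, Fin.sum_univ_four]

variable {R} in
/-- `w₂` preserves `J₄`. [cite: Casselman1980, §3] -/
theorem weylTwoM_unitary : ((weylTwoM R).map σ)ᵀ * antidiagFour R * weylTwoM R = antidiagFour R := by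
  ext i j
  fin_cases i <;> fin_cases j <;> simp [weylTwoM, antidiagFour, Matrix.mul_apply, Fin.sum_univ_four]

/-- **the Weyl letter `w₁ ∈ U(J₄)`** (`s_{α₁}`). [cite: Casselman1980, §3] [cite: Mok2014, §1 Notation p. 5] -/
def weylOne : unitaryGroupOfForm σ ((StdForm.antidiagonal 4).over R) :=
  unitaryOfMatrix' R σ (weylOneM R) (weylOneM_unitary σ)

/-- **the Weyl letter `w₂ ∈ U(J₄)`** (`s_{α₂}`). [cite: Casselman1980, §3] [cite: Mok2014, §1 Notation p. 5] -/
def weylTwo : unitaryGroupOfForm σ ((StdForm.antidiagonal 4).over R) :=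
  unitaryOfMatrix' R σ (weylTwoM R) (weylTwoM_unitary σ)

/-- matrix of `weylOne`. [cite: Casselman1980, §3] -/
@[simp] theorem coe_weylOne : (((weylOne R σ : unitaryGroupOfForm σ _) : GL (Fin 4) R) : Matrix (Fin 4) (Fin 4) R) = weylOneM R := rfl

/-- matrix of `weylTwo`. [cite: Casselman1980, §3] -/
@[simp] theorem coe_weylTwo : (((weylTwo R σ : unitaryGroupOfForm σ _) : GL (Fin 4) R) : Matrix (Fin 4) (Fin 4) R) = weylTwoM R := rfl

/-- `w₁² = 1`. [cite: Casselman1980, §3] -/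
theorem weylOne_mul_weylOne : weylOne R σ * weylOne R σ = 1 := by
  apply ext_of_coe
  rw [Subgroup.coe_mul, Units.val_mul, coe_weylOne, Subgroup.coe_one, Units.val_one]
  ext i j
  fin_cases i <;> fin_cases j <;> simp [weylOneM, Matrix.mul_apply, Fin.sum_univ_four]

/-- `w₂² = 1`. [cite: Casselman1980, §3] -/
theorem weylTwo_mul_weylTwo : weylTwo R σ * weylTwo R σ = 1 := by
  apply ext_of_coe
  rw [Subgroup.coe_mul, Units.val_mul, coe_weylTwo, Subgroup.coe_one, Units.val_one]
  ext i j
  fin_cases i <;> fin_cases j <;> simp [weylTwoM, Matrix.mul_apply, Fin.sum_univ_four]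

/-- **`w₂ u_{e₁−e₂}(z) = u_{e₁+e₂}(z) w₂`** (`s_{α₂}(α₁) = e₁ + e₂`). [cite: Casselman1980, §3] -/
theorem weylTwo_mul_uMinus (hσ : ∀ x, σ (σ x) = x) (z : R) : weylTwo R σ * uMinus R σ hσ z = uPlus R σ hσ z * weylTwo R σ := by
  apply ext_of_coe
  rw [Subgroup.coe_mul, Units.val_mul, Subgroup.coe_mul, Units.val_mul, coe_weylTwo, coe_uMinus, coe_uPlus]
  ext i j
  fin_cases i <;> fin_cases j <;> simp [weylTwoM, uMinusM, uPlusM, Matrix.mul_apply, Fin.sum_univ_four]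

/-- **`w₁ u_{2e₂}(x) = u_{2e₁}(x) w₁`** (`s_{α₁}(2e₂) = 2e₁`). [cite: Casselman1980, §3] -/
theorem weylOne_mul_uLongTwo (x : R) (hx : σ x = -x) : weylOne R σ * uLongTwo R σ x hx = uLongOne R σ x hx * weylOne R σ := by
  apply ext_of_coe
  rw [Subgroup.coe_mul, Units.val_mul, Subgroup.coe_mul, Units.val_mul, coe_weylOne, coe_uLongTwo, coe_uLongOne]
  ext i j
  fin_cases i <;> fin_cases j <;> simp [weylOneM, uLongTwoM, uLongOneM, Matrix.mul_apply, Fin.sum_univ_four]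

/-- **`w₂ u_{2e₁}(y) = u_{2e₁}(y) w₂`** (`s_{α₂}` fixes `2e₁`). [cite: Casselman1980, §3] -/
theorem weylTwo_mul_uLongOne (y : R) (hy : σ y = -y) : weylTwo R σ * uLongOne R σ y hy = uLongOne R σ y hy * weylTwo R σ := by
  apply ext_of_coe
  rw [Subgroup.coe_mul, Units.val_mul, Subgroup.coe_mul, Units.val_mul, coe_weylTwo, coe_uLongOne]
  ext i j
  fin_cases i <;> fin_cases j <;> simp [weylTwoM, uLongOneM, Matrix.mul_apply, Fin.sum_univ_four]

/-- **`w₁ t(a,b) = t(b,a) w₁`**. [cite: Casselman1980, §3] -/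
theorem weylOne_mul_torusElt (hσ : ∀ x, σ (σ x) = x) (a b : Rˣ) : weylOne R σ * torusElt R σ hσ a b = torusElt R σ hσ b a * weylOne R σ := by
  apply ext_of_coe
  rw [Subgroup.coe_mul, Units.val_mul, Subgroup.coe_mul, Units.val_mul, coe_weylOne, coe_torusElt, coe_torusElt]
  ext i j
  fin_cases i <;> fin_cases j <;> simp [weylOneM, torusM, Matrix.mul_apply, Fin.sum_univ_four]

/-- the unit `σ(b)⁻¹` as an element of `Rˣ` (for `σ` involutive): `Units.map σ b⁻¹`. [folklore] -/
theorem coe_map_inv (b : Rˣ) : ((Units.map (σ : R →* R) b⁻¹ : Rˣ) : R) = σ ((b⁻¹ : Rˣ) : R) := rfl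

/-- **`w₂ t(a,b) = t(a, σ(b)⁻¹) w₂`** (`s_{α₂}` inverts-and-conjugates the second coordinate). [cite: Casselman1980, §3] -/
theorem weylTwo_mul_torusElt (hσ : ∀ x, σ (σ x) = x) (a b : Rˣ) :
    weylTwo R σ * torusElt R σ hσ a b = torusElt R σ hσ a (Units.map (σ : R →* R) b⁻¹) * weylTwo R σ := by
  apply ext_of_coe
  rw [Subgroup.coe_mul, Units.val_mul, Subgroup.coe_mul, Units.val_mul, coe_weylTwo, coe_torusElt, coe_torusElt]
  ext i j
  fin_cases i <;> fin_cases j <;> simp [weylTwoM, torusM, Matrix.mul_apply, Fin.sum_univ_four, hσ, ← map_inv]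

/-! ## §5 The Siegel data of `U(J₄)` and the cocycle word -/

/-- **the Siegel Weyl element of `U(J₄)`**: `w_Δ := w₂ w₁ w₂` (the permutation `(0 2)(1 3)`, swapping the two diagonal `2 × 2` blocks; reduced word
`s₂ s₁ s₂` of length `3 = dim N_Δ`). [cite: HarrisKudlaSweet1996, §1 (1.12)] [cite: Casselman1980, §3] -/
def weylSiegel : unitaryGroupOfForm σ ((StdForm.antidiagonal 4).over R) := weylTwo R σ * weylOne R σ * weylTwo R σ

/-- matrix of `weylSiegel`: the permutation `(0 2)(1 3)`. [cite: HarrisKudlaSweet1996, §1 (1.12)] -/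
theorem coe_weylSiegel : (((weylSiegel R σ : unitaryGroupOfForm σ _) : GL (Fin 4) R) : Matrix (Fin 4) (Fin 4) R) =
    !![0, 0, 1, 0; 0, 0, 0, 1; 1, 0, 0, 0; 0, 1, 0, 0] := by
  rw [weylSiegel, Subgroup.coe_mul, Units.val_mul, Subgroup.coe_mul, Units.val_mul, coe_weylTwo, coe_weylOne]
  ext i j
  fin_cases i <;> fin_cases j <;> simp [weylTwoM, weylOneM, Matrix.mul_apply, Fin.sum_univ_four]

/-- `J₄` itself (the permutation `(0 3)(1 2)`) is `w_Δ · w₁` — the other block-swapping representative differs by the LEVI Weyl letter.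
[cite: HarrisKudlaSweet1996, §1 (1.12)] -/
theorem coe_weylSiegel_mul_weylOne : ((((weylSiegel R σ * weylOne R σ : unitaryGroupOfForm σ _)) : GL (Fin 4) R) : Matrix (Fin 4) (Fin 4) R) =
    antidiagFour R := by
  rw [Subgroup.coe_mul, Units.val_mul, coe_weylSiegel, coe_weylOne]
  ext i j
  fin_cases i <;> fin_cases j <;> simp [weylOneM, antidiagFour, Matrix.mul_apply, Fin.sum_univ_four]

/-- matrix of the Siegel unipotent `n(x,z,y) = [[1, X], [0, 1]]`, `X = (z y; x −σz)`. [cite: HarrisKudlaSweet1996, §1 (1.11)] -/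
def nSiegelM (x z y : R) : Matrix (Fin 4) (Fin 4) R := !![1, 0, z, y; 0, 1, x, -σ z; 0, 0, 1, 0; 0, 0, 0, 1]

/-- **the Siegel unipotent `n(x,z,y) := u_{2e₂}(x) · u_{e₁+e₂}(z) · u_{2e₁}(y) ∈ N_Δ(J₄)`** (`x, y` with `σ = −1`, `z ∈ R`: `N_Δ ≅ F ⊕ E ⊕ F` at a place).
[cite: HarrisKudlaSweet1996, §1 (1.11)] [cite: Casselman1980, §3] -/
def nSiegel (hσ : ∀ x, σ (σ x) = x) (x z y : R) (hx : σ x = -x) (hy : σ y = -y) : unitaryGroupOfForm σ ((StdForm.antidiagonal 4).over R) :=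
  uLongTwo R σ x hx * uPlus R σ hσ z * uLongOne R σ y hy

/-- **matrix of `n(x,z,y)`**: `[[1, X], [0, 1]]` with `X = (z y; x −σz)` (the three letters' nilpotent parts have pairwise zero products).
[cite: HarrisKudlaSweet1996, §1 (1.11)] -/
theorem coe_nSiegel (hσ : ∀ x, σ (σ x) = x) (x z y : R) (hx : σ x = -x) (hy : σ y = -y) :
    (((nSiegel R σ hσ x z y hx hy : unitaryGroupOfForm σ _) : GL (Fin 4) R) : Matrix (Fin 4) (Fin 4) R) = nSiegelM R σ x z y := by
  rw [nSiegel, Subgroup.coe_mul, Units.val_mul, Subgroup.coe_mul, Units.val_mul, coe_uLongTwo, coe_uPlus, coe_uLongOne]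
  ext i j
  fin_cases i <;> fin_cases j <;> simp [uLongTwoM, uPlusM, uLongOneM, nSiegelM, Matrix.mul_apply, Fin.sum_univ_four]

/-- the letters in the OPPOSITE order give the same element: `u_{2e₁}(y) u_{e₁+e₂}(z) u_{2e₂}(x) = n(x,z,y)` (`N_Δ` is commutative).
[cite: HarrisKudlaSweet1996, §1 (1.11)] -/
theorem uLongOne_mul_uPlus_mul_uLongTwo (hσ : ∀ x, σ (σ x) = x) (x z y : R) (hx : σ x = -x) (hy : σ y = -y) :
    uLongOne R σ y hy * uPlus R σ hσ z * uLongTwo R σ x hx = nSiegel R σ hσ x z y hx hy := by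
  apply ext_of_coe
  rw [coe_nSiegel, Subgroup.coe_mul, Units.val_mul, Subgroup.coe_mul, Units.val_mul, coe_uLongTwo, coe_uPlus, coe_uLongOne]
  ext i j
  fin_cases i <;> fin_cases j <;> simp [uLongTwoM, uPlusM, uLongOneM, nSiegelM, Matrix.mul_apply, Fin.sum_univ_four]

/-- additivity of the Siegel unipotent: `n(x,z,y) n(x′,z′,y′) = n(x+x′, z+z′, y+y′)` (`N_Δ ≅ (F ⊕ E ⊕ F, +)`). [cite: HarrisKudlaSweet1996, §1 (1.11)] -/
theorem nSiegel_mul (hσ : ∀ x, σ (σ x) = x) (x z y x' z' y' : R) (hx : σ x = -x) (hy : σ y = -y) (hx' : σ x' = -x') (hy' : σ y' = -y') :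
    nSiegel R σ hσ x z y hx hy * nSiegel R σ hσ x' z' y' hx' hy' =
      nSiegel R σ hσ (x + x') (z + z') (y + y') (by rw [map_add, hx, hx', neg_add]) (by rw [map_add, hy, hy', neg_add]) := by
  apply ext_of_coe
  rw [Subgroup.coe_mul, Units.val_mul, coe_nSiegel, coe_nSiegel, coe_nSiegel]
  ext i j
  fin_cases i <;> fin_cases j <;> simp [nSiegelM, Matrix.mul_apply, Fin.sum_univ_four, add_comm]

/-- the parametrisation `(x, z, y) ↦ n(x,z,y)` is injective. [cite: HarrisKudlaSweet1996, §1 (1.11)] -/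
theorem nSiegel_injective (hσ : ∀ x, σ (σ x) = x) {x z y x' z' y' : R} (hx : σ x = -x) (hy : σ y = -y) (hx' : σ x' = -x') (hy' : σ y' = -y')
    (h : nSiegel R σ hσ x z y hx hy = nSiegel R σ hσ x' z' y' hx' hy') : x = x' ∧ z = z' ∧ y = y' := by
  have hM : nSiegelM R σ x z y = nSiegelM R σ x' z' y' := by
    rw [← coe_nSiegel R σ hσ x z y hx hy, ← coe_nSiegel R σ hσ x' z' y' hx' hy', h]
  refine ⟨?_, ?_, ?_⟩
  · simpa [nSiegelM] using congrFun (congrFun hM 1) 2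
  · simpa [nSiegelM] using congrFun (congrFun hM 0) 2
  · simpa [nSiegelM] using congrFun (congrFun hM 0) 3

/-- **block-unitriangular elements of `U(J₄)` ARE Siegel unipotents**: if `g ∈ U(J₄)` has matrix `[[1, X], [0, 1]]` then `X = (z y; x −σz)` with
`σ x = −x`, `σ y = −y`, i.e. `g = n(x,z,y)` (the unitarity relation forces `X` to be `J₂`-skew-hermitian). [cite: HarrisKudlaSweet1996, §1 (1.11)] -/
theorem exists_eq_nSiegel (hσ : ∀ x, σ (σ x) = x) (g : unitaryGroupOfForm σ ((StdForm.antidiagonal 4).over R))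
    (h00 : ((g : GL (Fin 4) R) : Matrix (Fin 4) (Fin 4) R) 0 0 = 1) (h01 : ((g : GL (Fin 4) R) : Matrix (Fin 4) (Fin 4) R) 0 1 = 0)
    (h10 : ((g : GL (Fin 4) R) : Matrix (Fin 4) (Fin 4) R) 1 0 = 0) (h11 : ((g : GL (Fin 4) R) : Matrix (Fin 4) (Fin 4) R) 1 1 = 1)
    (h20 : ((g : GL (Fin 4) R) : Matrix (Fin 4) (Fin 4) R) 2 0 = 0) (h21 : ((g : GL (Fin 4) R) : Matrix (Fin 4) (Fin 4) R) 2 1 = 0)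
    (h30 : ((g : GL (Fin 4) R) : Matrix (Fin 4) (Fin 4) R) 3 0 = 0) (h31 : ((g : GL (Fin 4) R) : Matrix (Fin 4) (Fin 4) R) 3 1 = 0)
    (h22 : ((g : GL (Fin 4) R) : Matrix (Fin 4) (Fin 4) R) 2 2 = 1) (h23 : ((g : GL (Fin 4) R) : Matrix (Fin 4) (Fin 4) R) 2 3 = 0)
    (h32 : ((g : GL (Fin 4) R) : Matrix (Fin 4) (Fin 4) R) 3 2 = 0) (h33 : ((g : GL (Fin 4) R) : Matrix (Fin 4) (Fin 4) R) 3 3 = 1) :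
    ∃ (x z y : R) (hx : σ x = -x) (hy : σ y = -y), g = nSiegel R σ hσ x z y hx hy := by
  set M : Matrix (Fin 4) (Fin 4) R := ((g : GL (Fin 4) R) : Matrix (Fin 4) (Fin 4) R) with hMdef
  have hg : (M.map σ)ᵀ * antidiagFour R * M = antidiagFour R := by
    rw [← antidiagonal_over_four]
    exact g.2
  -- the four relevant entries of the relation
  have e33 := congrFun (congrFun hg 3) 3
  have e22 := congrFun (congrFun hg 2) 2
  have e23 := congrFun (congrFun hg 2) 3
  simp [Matrix.mul_apply, Fin.sum_univ_four, antidiagFour, h22, h23, h32, h33] at e33 e22 e23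
  refine ⟨M 1 2, M 0 2, M 0 3, ?_, ?_, ext_of_coe ?_⟩
  · linear_combination e22
  · linear_combination e33
  · rw [coe_nSiegel]
    ext i j
    fin_cases i <;> fin_cases j <;> simp [nSiegelM, ← hMdef, h00, h01, h10, h11, h20, h21, h30, h31, h22, h23, h32, h33]
    -- entry (1,3): `M 1 3 = -σ (M 0 2)`
    linear_combination e23

/-- ★★ **THE COCYCLE WORD**: `w_Δ · n(x,z,y) = (w₂ · u_{2e₂}(y)) · (w₁ · u_{e₁−e₂}(z)) · (w₂ · u_{2e₂}(x))` — the reduced word `w_Δ = s₂ s₁ s₂` read on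
`N_Δ = U_{2e₂} U_{e₁+e₂} U_{2e₁}`: each factor is a SIMPLE reflection times an element of ITS OWN simple root group, so
`∫_{N_Δ} f(w_Δ n h) dn = ∫_y ∫_z ∫_x f((w₂u₂(y))(w₁u₁(z))(w₂u₂(x)) h) = A₂(A₁(A₂ f))(h)` with the rank-one operators `A_i f (g) = ∫ f(w_i u_{α_i}(t) g) dt`
(`t₀ = 1`, no sign).  Proof: `w₁ u₂(y) = u_{2e₁}(y) w₁`, `u_{2e₁} w₂ = w₂ u_{2e₁}`, `u₁(z) w₂ = w₂ u₊(z)` and commutativity of `N_Δ`.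
[cite: Casselman1980, §3 Thm. 3.1 (the cocycle `T_{w} = T_{s₂}T_{s₁}T_{s₂}`)] [cite: HarrisKudlaSweet1996, §6 (6.14)] -/
theorem weylSiegel_mul_nSiegel (hσ : ∀ x, σ (σ x) = x) (x z y : R) (hx : σ x = -x) (hy : σ y = -y) :
    weylSiegel R σ * nSiegel R σ hσ x z y hx hy =
      (weylTwo R σ * uLongTwo R σ y hy) * (weylOne R σ * uMinus R σ hσ z) * (weylTwo R σ * uLongTwo R σ x hx) := by
  rw [← uLongOne_mul_uPlus_mul_uLongTwo, weylSiegel]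
  -- `w₂ u₂(y) w₁ u₁(z) w₂ u₂(x) = w₂ (u₂(y) w₁) (u₁(z) w₂) u₂(x) = w₂ (w₁ u_{2e₁}(y)) (w₂ u₊(z)) u₂(x) = w₂ w₁ (u_{2e₁}(y) w₂) u₊(z) u₂(x)`
  have h1 : uLongTwo R σ y hy * weylOne R σ = weylOne R σ * uLongOne R σ y hy := by
    have := congrArg (fun g => weylOne R σ * g * weylOne R σ) (weylOne_mul_uLongTwo R σ y hy)
    simp only [← mul_assoc, weylOne_mul_weylOne, one_mul] at this
    rw [mul_assoc (weylOne R σ * uLongOne R σ y hy), weylOne_mul_weylOne, mul_one] at this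
    exact this
  have h2 : uMinus R σ hσ z * weylTwo R σ = weylTwo R σ * uPlus R σ hσ z := by
    have := congrArg (fun g => weylTwo R σ * g * weylTwo R σ) (weylTwo_mul_uMinus R σ hσ z)
    simp only [← mul_assoc, weylTwo_mul_weylTwo, one_mul] at this
    rw [mul_assoc (weylTwo R σ * uPlus R σ hσ z), weylTwo_mul_weylTwo, mul_one] at this
    exact this
  have h3 : uLongOne R σ y hy * weylTwo R σ = weylTwo R σ * uLongOne R σ y hy := (weylTwo_mul_uLongOne R σ y hy).symm
  calc weylTwo R σ * weylOne R σ * weylTwo R σ * (uLongOne R σ y hy * uPlus R σ hσ z * uLongTwo R σ x hx)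
      = weylTwo R σ * weylOne R σ * (weylTwo R σ * uLongOne R σ y hy) * uPlus R σ hσ z * uLongTwo R σ x hx := by simp only [mul_assoc]
    _ = weylTwo R σ * weylOne R σ * (uLongOne R σ y hy * weylTwo R σ) * uPlus R σ hσ z * uLongTwo R σ x hx := by rw [h3]
    _ = weylTwo R σ * (weylOne R σ * uLongOne R σ y hy) * (weylTwo R σ * uPlus R σ hσ z) * uLongTwo R σ x hx := by simp only [mul_assoc]
    _ = weylTwo R σ * (uLongTwo R σ y hy * weylOne R σ) * (uMinus R σ hσ z * weylTwo R σ) * uLongTwo R σ x hx := by rw [h1, h2]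
    _ = (weylTwo R σ * uLongTwo R σ y hy) * (weylOne R σ * uMinus R σ hσ z) * (weylTwo R σ * uLongTwo R σ x hx) := by simp only [mul_assoc]

end Summit.HodgeConjecture.HodgeConjecture.Cruxes.HLiu418.K2LiuDoubledUTwoTwoWeylCocycle

end
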